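/-
Copyright (c) 2026 the pub-hodgecm-mathlib formalisation cell (harness21).  Prover seat hodgecm-mathlib-B-p08 (g41): req618 STAGE 1a «FOUR-FRAME» squad
(director s1808; heir LEAD F0P3a-plan (g18) DIRECTIVE v1.1 d3f1616d0136e728 D2 §1 item 3 «`stub_CensusDictionary` … consumes unit (i) (A-0, A-1, A-2)»); 2026-09-03.
Unit (i) ⊕: the module criterion A-0 and the defect-module shape A-1 combined into the CLOSED-FORM fixed-vertex test the type-(1) census reads.
-/
import Literature.NumberTheory.Automorphic.UnitaryThreeFourFrameDefectModuleShape   -- ★ A-1 (B-p08 (g41) p854564): `defectModuleShape_holds`, `exists_defectSet_latt_eq_span`; brings ★ A-0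
                                                                                  -- `UnitaryThreeFourFrameModuleCriterion` (`moduleCriterion_holds`), ★ «DEFS-1» `UnitaryThreeFourFrameDefs`,
                                                                                  -- ★ `UnitaryThreeFourFrameRankTwoShape` (`exists_mul_of_v_le`), ★ `CartanUnique` DVR kit
import HarnessLib

/-!
# The counting-ready fixed-vertex criterion in a frame: `γ_bΛ = Λ ⟺ |α−1| ≤ |ϖ|^{c₁−k} ∧ |β−1| ≤ |ϖ|^{c₂−k} ∧ |(α−1)ϖ^{c₂−k} − (β−1)·u·ϖ^{c₁−k}| ≤ |ϖ|^{c₁+c₂−k}`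
# («(D-RAM) FOUR-FRAME» road, unit (i) ⊕ = A-0 `ModuleCriterion` ⊕ A-1 `DefectModuleShape` in closed form)

Topic `NumberTheory/Automorphic`; namespace `Literature.NumberTheory.Automorphic.UnitaryThreeFourFrame` (the vocabulary namespace of ★ «DEFS-1» `UnitaryThreeFourFrameDefs`).
THEOREMS ONLY (no `def`, no instance, no notation, no named fact, no `sorry`); kernel lane `--supports stmt-HodgeConjecture-24833`.  Cell `pub/hodgecm-mathlib` (D-0151),
crux H413 = `stmt-HodgeConjecture-24833`, route `HCCMUnconditional`; in-house road «(D-RAM) FOUR-FRAME» under the leaf stub `stub_DyRamCore` (`Cruxes/H413/Lines/F0_P3c_DyadicPaydown.lean`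
ED. 4 :147), STAGE 1a (director s1808; heir LEAD F0P3a-plan (g18) DIRECTIVE v1.1 `F0/P3a/F0P3a-plan/g18/STAGE1a-DIRECTIVE-DRAM-FourFrame.v1_1.F0P3a-plan-g18.md` d3f1616d0136e728,
D2 §1 item 3 ∕ (R-7) layer 2: the census dictionary «consumes unit (i) (A-0 `ModuleCriterion`, A-1 `DefectModuleShape`, A-2)»).  Book of record memo v1.4
`F0/P3a/F0P3a-p01/g28/EVIDENCE-DRAM-FOUR-FRAME-LAW.F0P3ap01g28.md` 4b231cd3d1b58b69 §2 (A): «`γΛ ⊆ Λ ⇔ (α−1, β−1) ∈ M_Λ` … `n_t(γ)` depends on `γ` only through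
`(v(α−1), v(β−1)+v(α−β), r mod 𝔭^{…})`»; this file is the tree form of that reading: A-0 (★ `moduleCriterion_holds`, B-p04 (g61) p854563) says `γ_bΛ = Λ ⟺ (α−1, β−1) ∈ M_Λ^{(b)}`,
A-1 (★ `defectModuleShape_holds` ∕ `exists_defectSet_latt_eq_span`, B-p08 (g41) p854564) says `M_Λ^{(b)} = 𝒪(ϖ^{c₁},0) + 𝒪(0,ϖ^{c₂}) + 𝒪(ϖ^{c₁−k}u, ϖ^{c₂−k})`, and §1 below
computes MEMBERSHIP IN THAT SPAN IN CLOSED FORM, so that a census count only has to test three valuation inequalities in `(α−1, β−1)` against the vertex invariants `(c₁, c₂, k, u)`.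

THE MATHEMATICS (over the valuation ring `𝒪 = 𝒪[K]` of a field `K` with `Valued K ℤᵐ⁰`; `ϖ` a uniformiser, `|ϖ| = exp(−1)`).
* §1 **`mem_span_rankTwoShape_iff`** — for `k ≤ c₁`, `k ≤ c₂` and a unit `u`:
  `(x, y) ∈ 𝒪(ϖ^{c₁},0) + 𝒪(0,ϖ^{c₂}) + 𝒪(ϖ^{c₁−k}u, ϖ^{c₂−k}) ⟺ |x| ≤ |ϖ^{c₁−k}| ∧ |y| ≤ |ϖ^{c₂−k}| ∧ |x·ϖ^{c₂−k} − y·u·ϖ^{c₁−k}| ≤ |ϖ^{c₁+c₂−k}|`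
  (the third inequality is the gluing congruence `x∕(ϖ^{c₁−k}u) ≡ y∕ϖ^{c₂−k} (mod 𝔭^k)` cleared of denominators; the first is implied by the other two and kept for symmetry).
  (⇒) write `(x,y) = a(ϖ^{c₁},0) + b(0,ϖ^{c₂}) + c(ϖ^{c₁−k}u, ϖ^{c₂−k})`; then `xϖ^{c₂−k} − yuϖ^{c₁−k} = (a − bu)ϖ^{c₁}ϖ^{c₂−k}`.  (⇐) take `t = y∕ϖ^{c₂−k} ∈ 𝒪` and
  `r = (x − tuϖ^{c₁−k})∕ϖ^{c₁} = (xϖ^{c₂−k} − yuϖ^{c₁−k})∕(ϖ^{c₁}ϖ^{c₂−k}) ∈ 𝒪`; then `(x,y) = r(ϖ^{c₁},0) + t(ϖ^{c₁−k}u, ϖ^{c₂−k})`.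
* §2 **`mapGL_latt_eq_iff_of_defectSet_eq`** — A-0 ⊕ §1: in frame `b` of a four-frame family, for `α, β ∈ E¹`, `Γ = γ_b = frameElt σ f b α β` and a lattice `Λ = latt g` whose defect
  set in frame `b` is `𝒪(ϖ^{c₁},0) + 𝒪(0,ϖ^{c₂}) + 𝒪(ϖ^{c₁−k}u, ϖ^{c₂−k})` (as ★ `exists_defectSet_latt_eq_span` ∕ A-1 produce it):
  `ΓΛ = Λ ⟺ |α−1| ≤ |ϖ^{c₁−k}| ∧ |β−1| ≤ |ϖ^{c₂−k}| ∧ |(α−1)ϖ^{c₂−k} − (β−1)uϖ^{c₁−k}| ≤ |ϖ^{c₁+c₂−k}|`;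
  and the packaged form **`exists_invariants_mapGL_latt_eq_iff`**: for every lattice `latt g` and frame `b` there are invariants `(c₁, c₂, k, u)` (`c_i` the least axis exponents,
  `k ≤ min(c₁,c₂)`, `u` a unit) such that the closed-form test decides `γ_bΛ = Λ` for EVERY `α, β ∈ E¹` at once (the vertex data are independent of `γ`).
HONEST LABEL: HC_CM is proved only modulo the 7 printed citations (2 remaining named inputs: hLiu418 = stmt-HodgeConjecture-24832, h413 = stmt-HodgeConjecture-24833) until
rung 0 closes; this file is count-neutral (unit (i) module algebra of an in-house road; it pays no organ and moves no verdict; the road is registry-moving only on completion).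

## References
* [Lang2002] S. Lang, *Algebra*, rev. 3rd ed., GTM 211 (2002), Ch. III §7, Thm. 7.8 (elementary divisors ∕ stacked bases over a principal ring).
* [Serre1979] J.-P. Serre, *Local Fields*, GTM 67 (1979), Ch. I §1 (discrete valuation rings: divisibility = comparison of valuations).
* [Kottwitz1986] R. E. Kottwitz, *Stable trace formula: elliptic singular terms*, Math. Ann. 275 (1986), §3 (fixed lattices of a semisimple element = lattices stable under the order
  it generates; counting them through that order).
-/

set_option autoImplicit false

noncomputable section

open scoped Valued WithZero Matrix MatrixGroups
open Literature.NumberTheory.Automorphic Literature.NumberTheory.Automorphic.HermitianLattice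
  Literature.NumberTheory.Automorphic.UnitaryLatticeTree Literature.NumberTheory.Automorphic.CartanUnique

namespace Literature.NumberTheory.Automorphic.UnitaryThreeFourFrame

/-! ## §1  Membership in the rank-two shaped module, in closed form -/

section Membership

variable {K : Type*} [Field K] [Valued K ℤᵐ⁰]

/-- **MEMBERSHIP IN `𝒪(ϖ^{c₁},0) + 𝒪(0,ϖ^{c₂}) + 𝒪(ϖ^{c₁−k}u, ϖ^{c₂−k})` IN CLOSED FORM** (`k ≤ c₁`, `k ≤ c₂`, `u` a unit, `|ϖ| = exp(−1)`):
`(x, y)` lies in the span iff `|x| ≤ |ϖ^{c₁−k}|`, `|y| ≤ |ϖ^{c₂−k}|` and `|x·ϖ^{c₂−k} − y·u·ϖ^{c₁−k}| ≤ |ϖ^{c₁+c₂−k}|` (the gluing congruence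
`x∕(ϖ^{c₁−k}u) ≡ y∕ϖ^{c₂−k} (mod 𝔭^k)` cleared of denominators). [cite: Lang2002, Ch. III §7 Thm. 7.8] -/
theorem mem_span_rankTwoShape_iff {ϖ : K} (hϖ : Valued.v ϖ = WithZero.exp (-1 : ℤ)) {c₁ c₂ k : ℕ} (hk₁ : k ≤ c₁) (hk₂ : k ≤ c₂)
    {u : K} (hu : Valued.v u = 1) (x y : K) :
    (x, y) ∈ Submodule.span 𝒪[K] ({((ϖ ^ c₁ : K), (0 : K)), ((0 : K), (ϖ ^ c₂ : K)), (ϖ ^ (c₁ - k) * u, ϖ ^ (c₂ - k))} : Set (K × K)) ↔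
      Valued.v x ≤ Valued.v (ϖ ^ (c₁ - k)) ∧ Valued.v y ≤ Valued.v (ϖ ^ (c₂ - k)) ∧
        Valued.v (x * ϖ ^ (c₂ - k) - y * u * ϖ ^ (c₁ - k)) ≤ Valued.v (ϖ ^ (c₁ + c₂ - k)) := by
  have hϖ0 : ϖ ≠ 0 := uniformizer_ne_zero hϖ
  have hvpow := v_uniformizer_pow hϖ
  -- exponent bookkeeping: `ϖ^{c₁} ϖ^{c₂−k} = ϖ^{c₁+c₂−k} = ϖ^{c₂} ϖ^{c₁−k}`
  have e12 : (ϖ ^ c₁ * ϖ ^ (c₂ - k) : K) = ϖ ^ (c₁ + c₂ - k) := by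
    rw [← pow_add]; congr 1; omega
  have e21 : (ϖ ^ c₂ * ϖ ^ (c₁ - k) : K) = ϖ ^ (c₁ + c₂ - k) := by
    rw [← pow_add]; congr 1; omega
  constructor
  · -- (⇒): `(x, y) = a(ϖ^{c₁},0) + b(0,ϖ^{c₂}) + c(ϖ^{c₁−k}u, ϖ^{c₂−k})`
    intro h
    rw [Submodule.mem_span_insert] at h
    obtain ⟨a, z, hz, hxyz⟩ := h
    rw [Submodule.mem_span_pair] at hz
    obtain ⟨b, c, rfl⟩ := hz
    have hx : x = (a : K) * ϖ ^ c₁ + (c : K) * (ϖ ^ (c₁ - k) * u) := by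
      have := congrArg Prod.fst hxyz
      simpa [Prod.fst_add, Prod.smul_fst, Subring.smul_def, smul_eq_mul] using this
    have hy : y = (b : K) * ϖ ^ c₂ + (c : K) * ϖ ^ (c₂ - k) := by
      have := congrArg Prod.snd hxyz
      simpa [Prod.snd_add, Prod.smul_snd, Subring.smul_def, smul_eq_mul] using this
    have ha : Valued.v (a : K) ≤ 1 := a.2
    have hb : Valued.v (b : K) ≤ 1 := b.2
    have hc : Valued.v (c : K) ≤ 1 := c.2
    have hle₁ : Valued.v (ϖ ^ c₁) ≤ Valued.v (ϖ ^ (c₁ - k)) := by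
      rw [hvpow, hvpow, WithZero.exp_le_exp]; omega
    have hle₂ : Valued.v (ϖ ^ c₂) ≤ Valued.v (ϖ ^ (c₂ - k)) := by
      rw [hvpow, hvpow, WithZero.exp_le_exp]; omega
    refine ⟨?_, ?_, ?_⟩
    · rw [hx]
      refine (Valuation.map_add _ _ _).trans (max_le ?_ ?_)
      · rw [map_mul]; exact (mul_le_of_le_one_left' ha).trans hle₁
      · rw [map_mul, map_mul, hu, mul_one]; exact mul_le_of_le_one_left' hc
    · rw [hy]
      refine (Valuation.map_add _ _ _).trans (max_le ?_ ?_)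
      · rw [map_mul]; exact (mul_le_of_le_one_left' hb).trans hle₂
      · rw [map_mul]; exact mul_le_of_le_one_left' hc
    · have e : x * ϖ ^ (c₂ - k) - y * u * ϖ ^ (c₁ - k) = ((a : K) - (b : K) * u) * ϖ ^ (c₁ + c₂ - k) := by
        rw [hx, hy, ← e12]
        have e21' : (ϖ ^ c₂ * ϖ ^ (c₁ - k) : K) = ϖ ^ c₁ * ϖ ^ (c₂ - k) := by rw [e21, e12]
        linear_combination (-((b : K) * u)) * e21'
      rw [e, map_mul]
      refine mul_le_of_le_one_left' ((Valuation.map_sub _ _ _).trans (max_le ha ?_))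
      rw [map_mul, hu, mul_one]; exact hb
  · -- (⇐): `t = y ∕ ϖ^{c₂−k}`, `r = (xϖ^{c₂−k} − yuϖ^{c₁−k}) ∕ (ϖ^{c₁}ϖ^{c₂−k})`; `(x, y) = r(ϖ^{c₁},0) + t(ϖ^{c₁−k}u, ϖ^{c₂−k})`
    rintro ⟨-, h2, h3⟩
    obtain ⟨t, ht, hty⟩ := exists_mul_of_v_le (pow_ne_zero _ hϖ0) h2
    obtain ⟨r, hr, hrx⟩ := exists_mul_of_v_le (pow_ne_zero _ hϖ0) h3
    have hxy : ((x, y) : K × K) =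
        (⟨r, hr⟩ : 𝒪[K]) • ((ϖ ^ c₁ : K), (0 : K)) + (⟨t, ht⟩ : 𝒪[K]) • (ϖ ^ (c₁ - k) * u, ϖ ^ (c₂ - k)) := by
      ext
      · change x = r * ϖ ^ c₁ + t * (ϖ ^ (c₁ - k) * u)
        have hpow0 : (ϖ ^ (c₂ - k) : K) ≠ 0 := pow_ne_zero _ hϖ0
        apply mul_right_cancel₀ hpow0
        rw [add_mul, mul_assoc r, e12, ← hrx, hty]
        ring
      · change y = r * 0 + t * ϖ ^ (c₂ - k)
        rw [mul_zero, zero_add, hty]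
    rw [hxy]
    exact Submodule.add_mem _ (Submodule.smul_mem _ _ (Submodule.subset_span (by simp)))
      (Submodule.smul_mem _ _ (Submodule.subset_span (by simp)))

end Membership

/-! ## §2  The fixed-vertex criterion in a frame, in closed form (A-0 ⊕ A-1) -/

section Criterion

variable {K : Type} [Field K] [Valued K ℤᵐ⁰]

/-- **`γ_bΛ = Λ` IN CLOSED FORM.**  In frame `b` of a four-frame family `f` at `Φ₃` (`σ` an isometric involution), for `α, β ∈ E¹`, `Γ = γ_b = 1 + (α−1)π₀^{(b)} + (β−1)π₁^{(b)}`
(★ `frameElt`) and a lattice `Λ = latt g` whose defect set in frame `b` is `𝒪(ϖ^{c₁},0) + 𝒪(0,ϖ^{c₂}) + 𝒪(ϖ^{c₁−k}u, ϖ^{c₂−k})` (`k ≤ c₁, c₂`, `u` a unit — the output of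
★ `exists_defectSet_latt_eq_span` ∕ A-1): `ΓΛ = Λ ⟺ |α−1| ≤ |ϖ^{c₁−k}| ∧ |β−1| ≤ |ϖ^{c₂−k}| ∧ |(α−1)ϖ^{c₂−k} − (β−1)uϖ^{c₁−k}| ≤ |ϖ^{c₁+c₂−k}|`.
A-0 (★ `moduleCriterion_holds`) followed by `mem_span_rankTwoShape_iff`. [cite: Kottwitz1986, §3] -/
theorem mapGL_latt_eq_iff_of_defectSet_eq (σ : K →+* K) (hσ : ∀ x, σ (σ x) = x) (hvσ : ∀ a, Valued.v (σ a) = Valued.v a)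
    {ϖ : K} (hϖ : Valued.v ϖ = WithZero.exp (-1 : ℤ))
    (f : Fin 4 → Fin 3 → (Fin 3 → K)) (hf : IsFourFrameFamily σ f) {α β : K} (hα : α * σ α = 1) (hβ : β * σ β = 1)
    (b : Fin 4) (Γ : GL (Fin 3) K) (hΓ : (Γ : Matrix (Fin 3) (Fin 3) K) = frameElt σ f b α β) (g : GL (Fin 3) K)
    {c₁ c₂ k : ℕ} (hk₁ : k ≤ c₁) (hk₂ : k ≤ c₂) {u : K} (hu : Valued.v u = 1)
    (hM : defectSet (frameProj σ (f b 0)) (frameProj σ (f b 1)) (latt (g : Matrix (Fin 3) (Fin 3) K)) =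
      (Submodule.span 𝒪[K] ({((ϖ ^ c₁ : K), (0 : K)), ((0 : K), (ϖ ^ c₂ : K)), (ϖ ^ (c₁ - k) * u, ϖ ^ (c₂ - k))} : Set (K × K)) :
        Set (K × K))) :
    mapGL Γ (latt (g : Matrix (Fin 3) (Fin 3) K)) = latt (g : Matrix (Fin 3) (Fin 3) K) ↔
      Valued.v (α - 1) ≤ Valued.v (ϖ ^ (c₁ - k)) ∧ Valued.v (β - 1) ≤ Valued.v (ϖ ^ (c₂ - k)) ∧
        Valued.v ((α - 1) * ϖ ^ (c₂ - k) - (β - 1) * u * ϖ ^ (c₁ - k)) ≤ Valued.v (ϖ ^ (c₁ + c₂ - k)) := by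
  rw [moduleCriterion_holds σ hσ hvσ f hf α β hα hβ b Γ hΓ g, ← mem_span_rankTwoShape_iff hϖ hk₁ hk₂ hu, ← SetLike.mem_coe, ← hM]

/-- **THE VERTEX INVARIANTS DECIDE EVERY `γ_b` AT ONCE.**  For a four-frame family `f` at `Φ₃` (`σ` an isometric involution, `ϖ` a uniformiser), every frame `b` and every lattice
`Λ = latt g` there are invariants `(c₁, c₂, k, u)` — `c_i` the LEAST `c` with `ϖ^c π_i^{(b)} Λ ⊆ Λ`, `k ≤ min(c₁, c₂)`, `u` a unit (A-1) — such that for ALL `α, β ∈ E¹` and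
`Γ = γ_b`: `ΓΛ = Λ ⟺ |α−1| ≤ |ϖ^{c₁−k}| ∧ |β−1| ≤ |ϖ^{c₂−k}| ∧ |(α−1)ϖ^{c₂−k} − (β−1)uϖ^{c₁−k}| ≤ |ϖ^{c₁+c₂−k}|`.  This is memo v1.4 §2 (A)'s reading «`n_t(γ)` depends
on `γ` only through `(v(α−1), v(β−1), …, r mod 𝔭^…)`» made exact, vertex by vertex. [cite: Kottwitz1986, §3] [cite: Lang2002, Ch. III §7 Thm. 7.8] -/
theorem exists_invariants_mapGL_latt_eq_iff (σ : K →+* K) (hσ : ∀ x, σ (σ x) = x) (hvσ : ∀ a, Valued.v (σ a) = Valued.v a)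
    {ϖ : K} (hϖ : Valued.v ϖ = WithZero.exp (-1 : ℤ))
    (f : Fin 4 → Fin 3 → (Fin 3 → K)) (hf : IsFourFrameFamily σ f) (b : Fin 4) (g : GL (Fin 3) K) :
    ∃ (c₁ c₂ k : ℕ) (u : K), Valued.v u = 1 ∧ k ≤ c₁ ∧ k ≤ c₂ ∧
      IsLeast {c : ℕ | AxisStable ϖ (frameProj σ (f b 0)) (latt (g : Matrix (Fin 3) (Fin 3) K)) c} c₁ ∧
      IsLeast {c : ℕ | AxisStable ϖ (frameProj σ (f b 1)) (latt (g : Matrix (Fin 3) (Fin 3) K)) c} c₂ ∧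
      ∀ (α β : K), α * σ α = 1 → β * σ β = 1 →
        ∀ Γ : GL (Fin 3) K, (Γ : Matrix (Fin 3) (Fin 3) K) = frameElt σ f b α β →
          (mapGL Γ (latt (g : Matrix (Fin 3) (Fin 3) K)) = latt (g : Matrix (Fin 3) (Fin 3) K) ↔
            Valued.v (α - 1) ≤ Valued.v (ϖ ^ (c₁ - k)) ∧ Valued.v (β - 1) ≤ Valued.v (ϖ ^ (c₂ - k)) ∧
              Valued.v ((α - 1) * ϖ ^ (c₂ - k) - (β - 1) * u * ϖ ^ (c₁ - k)) ≤ Valued.v (ϖ ^ (c₁ + c₂ - k))) := by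
  obtain ⟨horth, hnz, -, -, -⟩ := hf b
  obtain ⟨c₁, c₂, k, u, hu, hk₁, hk₂, hc₁, hc₂, hEq⟩ :=
    exists_defectSet_latt_eq_span hϖ (frameProj_mul_self σ (hnz 0)) (frameProj_mul_self σ (hnz 1))
      (frameProj_mul_frameProj_of_pairing_eq_zero σ (horth 0 1 (by decide)))
      (frameProj_mul_frameProj_of_pairing_eq_zero σ (horth 1 0 (by decide)))
      (frameProj_ne_zero σ (hnz 0)) (frameProj_ne_zero σ (hnz 1)) g
  exact ⟨c₁, c₂, k, u, hu, hk₁, hk₂, hc₁, hc₂, fun α β hα hβ Γ hΓ =>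
    mapGL_latt_eq_iff_of_defectSet_eq σ hσ hvσ hϖ f hf hα hβ b Γ hΓ g hk₁ hk₂ hu hEq⟩

end Criterion

end Literature.NumberTheory.Automorphic.UnitaryThreeFourFrame

end
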